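import Summits.AtomisticToContinuum.FouriersLaw.Theorems.BondHeatUncertaintySubdiffusiveBondHeatKernelGibbsD
import Literature.MathematicalPhysics.KineticTheory.VelocityFlipNoise
import Mathlib.MeasureTheory.Integral.MeanInequalities

/-!
# `NonBallistic` / light cone, assembly part 2b: measure-theoretic tools for the synchronous coupling

Helper (`--supports stmt-AtomisticToContinuum-9127`) for stub `stub_lightConeWindow` (LC) of line `contact-current-forgetting`,
generic inputs of the flip-insensitivity assembly (all in the Lebesgue-integral / `ℝ≥0∞` form):

* `lintegral_lintegral_solMap_gibbs` — STATIONARITY of the constructed kernel process started from the Gibbs measure, on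
  the Wiener space: `∫⁻ x, ∫⁻ ω, g(Φ_s(x, B ω)) dW dμ_T = ∫⁻ g dμ_T` for every measurable `g ≥ 0` and `s ≥ 0` (kernel = law of
  the solution map, `pinnedChain_lintegral_transitionKernel`; Gibbs invariance `pinnedChain_gibbsMeasure_bind_transitionKernel`,
  NO uniqueness needed);
* `lintegral_comp_momentumFlip_gibbs` — a single-site momentum flip preserves every Gibbs integral
  (`measurePreserving_momentumFlip_gibbsMeasure`);
* `lintegral_indicator_mul_le_sqrt` — Hölder on an event: `∫⁻_B f ≤ (∫⁻ f²)^{1/2} · π(B)^{1/2}`.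
-/

noncomputable section

namespace Summit.AtomisticToContinuum.FouriersLaw.Theorems.NonBallistic

open MeasureTheory ProbabilityTheory Set Filter Topology
open scoped NNReal ENNReal
open Literature.MathematicalPhysics.KineticTheory.HeatConduction
open Literature.Probability.Process
open Summit.AtomisticToContinuum.FouriersLaw.Theorems.SubdiffusiveBondHeat

namespace FSAssembly

variable {ω₂ lam β γ : ℝ} (hω : 0 < ω₂) (hl : 0 ≤ lam) (hβ : 0 ≤ β) (hγ : 0 ≤ γ) {N : ℕ} (hN : 0 < N)
  {T : ℝ} (hT : 0 < T)

include hω hl hβ hγ hN hT in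
/-- **Stationarity on the Wiener space.** For measurable `g ≥ 0` and `s ≥ 0`,
`∫⁻ x, ∫⁻ ω, g (Φ_s(x, B ω)) dW dμ_T = ∫⁻ g dμ_T`: the law of the strong solution at time `s` started from the Gibbs
measure and driven by an independent Brownian pair is again the Gibbs measure. -/
theorem lintegral_lintegral_solMap_gibbs {g : PhaseSpace N → ℝ≥0∞} (hg : Measurable g) (s : ℝ≥0) :
    ∫⁻ x, ∫⁻ ω, g ((pinnedChain ω₂ lam β γ).solMap N T T s x (pairPath ω)) ∂wienerPair
        ∂((pinnedChain ω₂ lam β γ).gibbsMeasure N T) =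
      ∫⁻ x, g x ∂((pinnedChain ω₂ lam β γ).gibbsMeasure N T) := by
  set P := pinnedChain ω₂ lam β γ with hP
  have h1 : ∀ x, ∫⁻ ω, g (P.solMap N T T s x (pairPath ω)) ∂wienerPair = ∫⁻ y, g y ∂(P.transitionKernel N T T s x) :=
    fun x => (pinnedChain_lintegral_transitionKernel hω hl hβ hγ N T T s x hg).symm
  simp_rw [h1]
  rw [← Measure.lintegral_bind (P.transitionKernel N T T s).measurable.aemeasurable hg.aemeasurable,
    pinnedChain_gibbsMeasure_bind_transitionKernel hω hl hβ hγ hN hT s]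

/-- A single-site momentum flip preserves every Gibbs `ℝ≥0∞`-integral. -/
theorem lintegral_comp_momentumFlip_gibbs (P : OscillatorChain) (N : ℕ) (T : ℝ) (i : Fin N)
    {F : PhaseSpace N → ℝ≥0∞} (hF : Measurable F) :
    ∫⁻ x, F (momentumFlip i x) ∂(P.gibbsMeasure N T) = ∫⁻ x, F x ∂(P.gibbsMeasure N T) :=
  (OscillatorChain.measurePreserving_momentumFlip_gibbsMeasure P N T i).lintegral_comp hF

/-- **Hölder on an event**: `∫⁻ 1_B · f ≤ (∫⁻ f²)^{1/2} · π(B)^{1/2}` for measurable `f ≥ 0` and a measurable set `B`. -/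
theorem lintegral_indicator_mul_le_sqrt {α : Type*} [MeasurableSpace α] (π : Measure α) {f : α → ℝ≥0∞}
    (hf : Measurable f) {B : Set α} (hB : MeasurableSet B) :
    ∫⁻ a, B.indicator (fun _ => (1 : ℝ≥0∞)) a * f a ∂π ≤ (∫⁻ a, f a ^ 2 ∂π) ^ (1 / 2 : ℝ) * π B ^ (1 / 2 : ℝ) := by
  have hg : Measurable (B.indicator fun _ => (1 : ℝ≥0∞)) := measurable_const.indicator hB
  have key := ENNReal.lintegral_mul_le_Lp_mul_Lq π Real.HolderConjugate.two_two hf.aemeasurable hg.aemeasurable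
  have hind : ∫⁻ a, (B.indicator (fun _ => (1 : ℝ≥0∞)) a) ^ (2 : ℝ) ∂π = π B := by
    have : (fun a => (B.indicator (fun _ => (1 : ℝ≥0∞)) a) ^ (2 : ℝ)) = B.indicator fun _ => (1 : ℝ≥0∞) := by
      funext a
      by_cases ha : a ∈ B
      · simp [ha]
      · simp [ha]
    rw [this, lintegral_indicator hB, setLIntegral_const, one_mul]
  have hf2 : ∫⁻ a, f a ^ (2 : ℝ) ∂π = ∫⁻ a, f a ^ 2 ∂π := by
    refine lintegral_congr fun a => ?_
    rw [← ENNReal.rpow_natCast]; norm_num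
  calc ∫⁻ a, B.indicator (fun _ => (1 : ℝ≥0∞)) a * f a ∂π = ∫⁻ a, (f * B.indicator fun _ => (1 : ℝ≥0∞)) a ∂π := by
        refine lintegral_congr fun a => ?_
        simp [mul_comm]
    _ ≤ (∫⁻ a, f a ^ (2 : ℝ) ∂π) ^ (1 / (2 : ℝ)) * (∫⁻ a, (B.indicator (fun _ => (1 : ℝ≥0∞)) a) ^ (2 : ℝ) ∂π) ^ (1 / (2 : ℝ)) :=
        key
    _ = (∫⁻ a, f a ^ 2 ∂π) ^ (1 / 2 : ℝ) * π B ^ (1 / 2 : ℝ) := by rw [hind, hf2]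

/-- Markov's inequality in the form used by the assembly: `π {a | c < f a} ≤ (∫⁻ f) / c` for `0 < c < ∞`. -/
theorem meas_gt_le_lintegral_div {α : Type*} [MeasurableSpace α] (π : Measure α) {f : α → ℝ≥0∞}
    (hf : Measurable f) {c : ℝ≥0∞} (hc : c ≠ 0) (hc' : c ≠ ∞) :
    π {a | c < f a} ≤ (∫⁻ a, f a ∂π) / c := by
  have h1 : π {a | c < f a} ≤ π {a | c ≤ f a} :=
    measure_mono fun a (ha : c < f a) => show c ≤ f a from le_of_lt ha
  have h2 : c * π {a | c ≤ f a} ≤ ∫⁻ a, f a ∂π := mul_meas_ge_le_lintegral hf c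
  calc π {a | c < f a} ≤ π {a | c ≤ f a} := h1
    _ = c * π {a | c ≤ f a} / c := by rw [mul_comm, ENNReal.mul_div_cancel_right hc hc']
    _ ≤ (∫⁻ a, f a ∂π) / c := ENNReal.div_le_div_right h2 c

end FSAssembly

end Summit.AtomisticToContinuum.FouriersLaw.Theorems.NonBallistic

end
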